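import Literature.Analysis.ValidatedNumerics.TaylorModel
import Literature.Analysis.ValidatedNumerics.ListPolynomial
import Mathlib.Algebra.Polynomial.Taylor
import Mathlib.Algebra.Polynomial.HasseDeriv
import Mathlib.MeasureTheory.Integral.IntervalIntegral.Basic
import Mathlib.Analysis.SpecialFunctions.Integrals.Basic
import HarnessLib

/-!
# Moment contraction of a local Taylor table against a panel kernel

Trunk T-ANA (Analysis/ValidatedNumerics); namespace `Literature.Analysis.ValidatedNumerics.PolyMP`.

The kernel-cheap building block of panelled moving integrals whose integrand carries a smooth factor `f` known through a
LOCAL TAYLOR TABLE: a truncated interval coefficient list `Atr` enclosing fixed reals `a_0 … a_D`, a scaled remainder `e`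
with `|f(s) − Σ a_r s^r|·S ≤ e` on `|s| ≤ R`, and a scaled range bound `sup` (`TabOK S R f Atr e sup`; produced from an exact
interval coefficient list by `tabOK_entry` — `take`, `tailBoundI`, `tabsI`).  For a kernel `K ≥ 0` on the panel `[-h, h]`
with certified moments `μ_b ∋ ∫_{-h}^{h} K(u) u^b du` and `2h ≤ R`,

  `ρ ↦ ∫_{-h}^{h} K(u) f(ρ + σu) du`,  `σ = ±1`,

is enclosed on `|ρ| ≤ h` by the Taylor model `widen0 (contrI S Atr μ σ) ⌈e μ₀⁺/S⌉` (`tmem_contrI`): coefficient `a` of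
`contrI` is `Σ_b A_{a+b} C(a+b,a) σ^b μ_b` (integer interval arithmetic only — no exact polynomial algebra), by the Taylor
coefficient formula `p(ρ+v) = Σ_a ρ^a Σ_b p_{a+b} C(a+b,a) v^b` (`evalR_add_eq_sum`, from `Polynomial.taylor`/`hasseDeriv`).
Problem-independent; no facts, no axioms.

## References

* K. Makino, M. Berz, *Taylor models and other validated functional inclusion methods*, Int. J. Pure Appl. Math. 4 (2003)
  379–456, §6 (integration of Taylor models). [folklore]
-/

open MeasureTheory intervalIntegral Set Finset Polynomial

namespace Literature.Analysis.ValidatedNumerics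

namespace PolyMP

open Literature.Analysis.ValidatedNumerics.NumericsMP

/-! ## Local Taylor tables -/

/-- A local Taylor table of `f` on `|s| ≤ R`: fixed coefficients in `Atr`, scaled remainder `e`, scaled range bound `sup`.
[folklore] -/
def TabOK (S : ℕ) (R : ℚ) (f : ℝ → ℝ) (Atr : IPoly) (e sup : ℤ) : Prop :=
  ∃ as : List ℝ, PMem S as Atr ∧ (∀ s : ℝ, |s| ≤ R → |f s - evalR as s| * S ≤ e) ∧
    (∀ s : ℝ, |s| ≤ R → |evalR as s| * S ≤ sup)

/-- The table entry computed from an exact-degree interval coefficient list `A`: truncation to degree `D`, the tail bound on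
radius `R`, the range bound. [folklore] -/
def tabEntry (S : ℕ) (R : ℚ) (D : ℕ) (A : IPoly) : IPoly × ℤ × ℤ :=
  (A.take (D + 1), tailBoundI S R (D + 1) (A.drop (D + 1)), tabsI S R (A.take (D + 1)))

/-- **Soundness of `tabEntry`**: if `A` encloses FIXED coefficients `as` with `f(s) = Σ as_r s^r` for all `s`, the entry is a
local Taylor table of `f` on `|s| ≤ R`. [folklore] -/
theorem tabOK_entry {S : ℕ} {R : ℚ} (hR : 0 ≤ R) (D : ℕ) {f : ℝ → ℝ} {as : List ℝ} {A : IPoly} (has : PMem S as A)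
    (hf : ∀ s, f s = evalR as s) :
    TabOK S R f (tabEntry S R D A).1 (tabEntry S R D A).2.1 (tabEntry S R D A).2.2 := by
  simp only [tabEntry]
  refine ⟨as.take (D + 1), pmem_take (D + 1) has, fun s hs => ?_, fun s hs => ?_⟩
  · rw [hf s, evalR_take_add_drop (D + 1) as s]
    have := tail_le_tailBoundI hR (D + 1) (pmem_drop (D + 1) has) hs
    simpa [add_sub_cancel_left] using this
  · exact abs_le_tabsI hR (fun ρ _ => ⟨as.take (D + 1), pmem_take (D + 1) has, rfl⟩) hs

/-- A table gives a Taylor model (remainder folded into the constant coefficient). [folklore] -/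
theorem tmem_of_tabOK {S : ℕ} {R : ℚ} {f : ℝ → ℝ} {Atr : IPoly} {e sup : ℤ} (hT : TabOK S R f Atr e sup) :
    TMem S R f (widen0 Atr e) := fun s hs => by
  obtain ⟨as, has, hrem, _⟩ := hT
  obtain ⟨bs, hbs, eb⟩ := exists_widen0 has (hrem s hs) s
  exact ⟨bs, hbs, by rw [eb]; ring⟩

/-! ## Evaluation as a finite sum and the Taylor coefficient formula -/

/-- `evalR as x = Σ_{i < |as|} as_i x^i`. [folklore] -/
theorem evalR_eq_sum : ∀ (as : List ℝ) (x : ℝ),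
    evalR as x = ∑ i ∈ range as.length, as.getD i 0 * x ^ i
  | [], x => by simp
  | a :: as, x => by
      rw [evalR_cons, evalR_eq_sum as x, List.length_cons, Finset.sum_range_succ', Finset.mul_sum]
      simp only [List.getD_cons_succ, List.getD_cons_zero, pow_zero, mul_one, pow_succ]
      rw [add_comm]
      congr 1
      exact Finset.sum_congr rfl fun i _ => by ring

/-- `natDegree (toPoly as) < |as|` for a nonempty list. [folklore] -/
theorem natDegree_toPoly_lt {as : List ℝ} (h : as ≠ []) : (toPoly as).natDegree < as.length := by
  rcases Nat.eq_zero_or_pos (toPoly as).natDegree with h0 | hpos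
  · rw [h0]; exact List.length_pos_iff.2 h
  · by_contra hle
    rw [not_lt] at hle
    have hc : (toPoly as).coeff (toPoly as).natDegree = 0 := by
      rw [coeff_toPoly, List.getD_eq_getElem?_getD, List.getElem?_eq_none (by omega)]; rfl
    have hne : toPoly as ≠ 0 := fun hz => by rw [hz, natDegree_zero] at hpos; exact lt_irrefl 0 hpos
    exact (leadingCoeff_ne_zero.2 hne) hc

/-- **Taylor coefficient formula**: `p(x + v) = Σ_{a<n} x^a · Σ_{b<n−a} p_{a+b} C(a+b, a) v^b`, `n = |as|`. [folklore] -/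
theorem evalR_add_eq_sum (as : List ℝ) (x v : ℝ) :
    evalR as (x + v) = ∑ a ∈ range as.length, x ^ a *
      ∑ b ∈ range (as.length - a), as.getD (a + b) 0 * ((a + b).choose a : ℝ) * v ^ b := by
  rcases eq_or_ne as [] with h | h
  · subst h; simp
  set n := as.length with hn
  set p : ℝ[X] := toPoly as with hp
  have hdeg : p.natDegree < n := natDegree_toPoly_lt h
  rw [← eval_toPoly, ← hp, ← taylor_eval, eval_eq_sum_range' (lt_of_le_of_lt (natDegree_taylor _ _).le hdeg)]
  refine Finset.sum_congr rfl fun a ha => ?_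
  rw [mul_comm, taylor_coeff]
  congr 1
  have hdeg' : (hasseDeriv a p).natDegree < n :=
    lt_of_le_of_lt ((natDegree_hasseDeriv_le p a).trans (Nat.sub_le _ _)) hdeg
  rw [eval_eq_sum_range' hdeg']
  have ha' : a ≤ n := (Finset.mem_range.1 ha).le
  rw [← Nat.sub_add_cancel ha', Finset.sum_range_add]
  have hz : ∑ k ∈ range a, (hasseDeriv a p).coeff (n - a + k) * v ^ (n - a + k) = 0 := by
    refine Finset.sum_eq_zero fun k _ => ?_
    rw [hasseDeriv_coeff, hp, coeff_toPoly, List.getD_eq_getElem?_getD, List.getElem?_eq_none (by omega)]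
    simp
  rw [hz, add_zero, Nat.sub_add_cancel ha']
  refine Finset.sum_congr rfl fun b _ => ?_
  rw [hasseDeriv_coeff, hp, coeff_toPoly, show b + a = a + b from add_comm b a]
  ring

/-- `evalR as` is continuous. [folklore] -/
theorem continuous_evalR : ∀ as : List ℝ, Continuous (evalR as)
  | [] => by
      have : evalR [] = fun _ => (0 : ℝ) := funext fun x => rfl
      rw [this]; exact continuous_const
  | a :: as => by
      have : evalR (a :: as) = fun x => a + x * evalR as x := funext fun x => rfl
      rw [this]
      exact continuous_const.add (continuous_id.mul (continuous_evalR as))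

/-! ## The contraction -/

/-- Coefficient `a` of `Σ_b A_{a+b} C(a+b, a) σ^b μ_b` (integer interval arithmetic). [folklore] -/
def contrI (S : ℕ) (A : IPoly) (mu : List MI) (sgn : ℤ) : IPoly :=
  (List.range A.length).map fun a =>
    (List.range (A.length - a)).foldl
      (fun acc b => MI.add acc
        (MI.mul S (MI.mulInt (A.getD (a + b) default) (((a + b).choose a : ℕ) * sgn ^ b)) (mu.getD b default)))
      (MI.ofScaled 0)

/-- `0 ∈ ofScaled 0`. [folklore] -/
theorem mem_zero_ofScaled (S : ℕ) : MI.mem S (0 : ℝ) (MI.ofScaled 0) := by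
  simp [MI.mem, MI.ofScaled]

/-- Membership in an accumulated interval sum over `range n`. [folklore] -/
theorem mem_foldl_add {S : ℕ} {x : ℕ → ℝ} {X : ℕ → MI} :
    ∀ n : ℕ, (∀ b, b < n → MI.mem S (x b) (X b)) →
      MI.mem S (∑ b ∈ range n, x b) ((List.range n).foldl (fun acc b => MI.add acc (X b)) (MI.ofScaled 0))
  | 0, _ => by simpa using mem_zero_ofScaled S
  | n + 1, hx => by
      rw [List.range_succ, List.foldl_append, List.foldl_cons, List.foldl_nil, Finset.sum_range_succ]
      exact MI.mem_add (mem_foldl_add n fun b hb => hx b (by omega)) (hx n (by omega))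

/-- `getD` membership from `PMem` (index in range). [folklore] -/
theorem mem_getD_of_pmem {S : ℕ} : ∀ {as : List ℝ} {P : IPoly}, PMem S as P → ∀ {i : ℕ}, i < P.length →
    MI.mem S (as.getD i 0) (P.getD i default)
  | _, _, List.Forall₂.nil, i, hi => by simp at hi
  | _, _, List.Forall₂.cons ha hP, 0, _ => by simpa using ha
  | _, _, List.Forall₂.cons ha hP, i + 1, hi => by
      simp only [List.getD_cons_succ]
      exact mem_getD_of_pmem hP (by simpa using hi)

/-- `getD` beyond the length of an enclosed list is `0`. [folklore] -/
theorem getD_eq_zero_of_pmem {S : ℕ} {as : List ℝ} {P : IPoly} (h : PMem S as P) {i : ℕ} (hi : P.length ≤ i) :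
    as.getD i 0 = 0 := by
  rw [List.getD_eq_getElem?_getD, List.getElem?_eq_none (by rw [h.length_eq]; exact hi)]
  rfl

/-- **The contraction encloses the contracted coefficients.**  If `as ∈ Atr` coefficientwise and `m_b ∈ μ_b` for
`b < |Atr|`, then the list `c_a = Σ_{b < |Atr| − a} as_{a+b} C(a+b,a) σ^b m_b` lies in `contrI S Atr μ σ`. [folklore] -/
theorem pmem_contrI {S : ℕ} (hS : 0 < S) {as : List ℝ} {Atr : IPoly} (has : PMem S as Atr) {m : ℕ → ℝ}
    {mu : List MI} (hmu : ∀ b, b < Atr.length → MI.mem S (m b) (mu.getD b default)) (sgn : ℤ) :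
    PMem S ((List.range Atr.length).map fun a =>
        ∑ b ∈ range (Atr.length - a), as.getD (a + b) 0 * ((a + b).choose a : ℝ) * (sgn : ℝ) ^ b * m b)
      (contrI S Atr mu sgn) := by
  unfold contrI
  have key : ∀ a, a < Atr.length → MI.mem S
      (∑ b ∈ range (Atr.length - a), as.getD (a + b) 0 * ((a + b).choose a : ℝ) * (sgn : ℝ) ^ b * m b)
      ((List.range (Atr.length - a)).foldl
        (fun acc b => MI.add acc
          (MI.mul S (MI.mulInt (Atr.getD (a + b) default) (((a + b).choose a : ℕ) * sgn ^ b)) (mu.getD b default)))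
        (MI.ofScaled 0)) := by
    intro a ha
    refine mem_foldl_add (x := fun b => as.getD (a + b) 0 * ((a + b).choose a : ℝ) * (sgn : ℝ) ^ b * m b)
      (X := fun b => MI.mul S (MI.mulInt (Atr.getD (a + b) default) (((a + b).choose a : ℕ) * sgn ^ b))
        (mu.getD b default)) _ fun b hb => ?_
    have hab : a + b < Atr.length := by omega
    have h1 := MI.mem_mulInt (mem_getD_of_pmem has hab) (((a + b).choose a : ℕ) * sgn ^ b)
    have h2 := MI.mem_mul hS h1 (hmu b (by omega))
    push_cast at h2
    convert h2 using 1
    ring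
  -- assemble over `List.range`
  have : ∀ l : List ℕ, (∀ a ∈ l, a < Atr.length) →
      PMem S (l.map fun a => ∑ b ∈ range (Atr.length - a), as.getD (a + b) 0 * ((a + b).choose a : ℝ) *
          (sgn : ℝ) ^ b * m b)
        (l.map fun a => (List.range (Atr.length - a)).foldl
          (fun acc b => MI.add acc
            (MI.mul S (MI.mulInt (Atr.getD (a + b) default) (((a + b).choose a : ℕ) * sgn ^ b)) (mu.getD b default)))
          (MI.ofScaled 0)) := by
    intro l hl
    induction l with
    | nil => exact pmem_nil S
    | cons a l ih =>
        simp only [List.map_cons]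
        exact pmem_cons (key a (hl a (by simp))) (ih fun x hx => hl x (by simp [hx]))
  exact this _ fun a ha => List.mem_range.1 ha

/-! ## The integral of a kernel against a shifted table function -/

section Integral

variable {S : ℕ} {h R : ℚ} {K f : ℝ → ℝ}

/-- `u ↦ K(u)·g(u)` is interval integrable when `K` is and `g` is continuous. [folklore] -/
theorem intervalIntegrable_kernel_mul (hK : IntervalIntegrable K volume (-(h : ℝ)) h) {g : ℝ → ℝ}
    (hg : Continuous g) : IntervalIntegrable (fun u => K u * g u) volume (-(h : ℝ)) h :=
  hK.mul_continuousOn hg.continuousOn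

/-- **The contraction Taylor model.**  `K ≥ 0` interval integrable on `[-h, h]`, `μ_b ∋ ∫ K u^b` (`b < |Atr|`), `f` continuous
with a local table on `|s| ≤ R`, `2h ≤ R`, `σ = ±1`: then on `|ρ| ≤ h`,
`∫_{-h}^{h} K(u) f(ρ + σu) du ∈ widen0 (contrI S Atr μ σ) ⌈e·μ₀⁺/S⌉`. [folklore] -/
theorem tmem_contrI (hS : 0 < S) (h0 : 0 ≤ h) (hR : 2 * h ≤ R) {Atr : IPoly} {e sup : ℤ}
    (hT : TabOK S R f Atr e sup) (hf : Continuous f) (hK : IntervalIntegrable K volume (-(h : ℝ)) h)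
    (hK0 : ∀ u ∈ Icc (-(h : ℝ)) h, 0 ≤ K u) {mu : List MI}
    (hmu : ∀ b, b < Atr.length → MI.mem S (∫ u in (-(h : ℝ))..h, K u * u ^ b) (mu.getD b default))
    (hlen : 0 < Atr.length) {sgn : ℤ} (hsgn : sgn = 1 ∨ sgn = -1) :
    TMem S h (fun ρ => ∫ u in (-(h : ℝ))..h, K u * f (ρ + sgn * u))
      (widen0 (contrI S Atr mu sgn) ⌈((e * (mu.getD 0 default).hi : ℤ) : ℚ) / S⌉) := by
  obtain ⟨as, has, hrem, _⟩ := hT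
  intro ρ hρ
  have hhr : (0 : ℝ) ≤ h := by exact_mod_cast h0
  have hSr : (0 : ℝ) < S := by exact_mod_cast hS
  set n := Atr.length with hn
  have hlen' : as.length = n := has.length_eq
  -- the polynomial part and the remainder
  set P : ℝ → ℝ := fun s => evalR as s with hP
  set r : ℝ → ℝ := fun s => f s - P s with hr
  have hσabs : |(sgn : ℝ)| = 1 := by rcases hsgn with h1 | h1 <;> simp [h1]
  have harg : ∀ u ∈ Icc (-(h : ℝ)) h, |ρ + sgn * u| ≤ R := by
    intro u hu
    have hu' : |u| ≤ h := abs_le.2 ⟨hu.1, hu.2⟩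
    have hR' : (2 : ℝ) * h ≤ R := by exact_mod_cast hR
    calc |ρ + sgn * u| ≤ |ρ| + |(sgn : ℝ) * u| := abs_add_le _ _
      _ = |ρ| + |u| := by rw [abs_mul, hσabs, one_mul]
      _ ≤ R := by linarith
  have hPc : Continuous P := continuous_evalR as
  have hshift : Continuous fun u : ℝ => ρ + sgn * u := by fun_prop
  have hIf : IntervalIntegrable (fun u => K u * f (ρ + sgn * u)) volume (-(h : ℝ)) h :=
    intervalIntegrable_kernel_mul hK (hf.comp hshift)
  have hIP : IntervalIntegrable (fun u => K u * P (ρ + sgn * u)) volume (-(h : ℝ)) h :=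
    intervalIntegrable_kernel_mul hK (hPc.comp hshift)
  have hIr : IntervalIntegrable (fun u => K u * r (ρ + sgn * u)) volume (-(h : ℝ)) h := by
    have : (fun u => K u * r (ρ + sgn * u)) = fun u => K u * f (ρ + sgn * u) - K u * P (ρ + sgn * u) := by
      funext u; simp only [hr]; ring
    rw [this]; exact hIf.sub hIP
  -- split the integral
  have hsplit : ∫ u in (-(h : ℝ))..h, K u * f (ρ + sgn * u) =
      (∫ u in (-(h : ℝ))..h, K u * P (ρ + sgn * u)) + ∫ u in (-(h : ℝ))..h, K u * r (ρ + sgn * u) := by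
    rw [← intervalIntegral.integral_add hIP hIr]
    exact intervalIntegral.integral_congr fun u _ => by simp only [hr]; ring
  -- the polynomial part, termwise
  set m : ℕ → ℝ := fun b => ∫ u in (-(h : ℝ))..h, K u * u ^ b with hm
  set cs : List ℝ := (List.range n).map fun a =>
      ∑ b ∈ range (n - a), as.getD (a + b) 0 * ((a + b).choose a : ℝ) * (sgn : ℝ) ^ b * m b with hcs
  have hpoly : ∫ u in (-(h : ℝ))..h, K u * P (ρ + sgn * u) = evalR cs ρ := by
    have e1 : ∀ u, K u * P (ρ + sgn * u) = ∑ a ∈ range n, ∑ b ∈ range (n - a),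
        (ρ ^ a * (as.getD (a + b) 0 * ((a + b).choose a : ℝ) * (sgn : ℝ) ^ b)) * (K u * u ^ b) := by
      intro u
      simp only [hP]
      rw [evalR_add_eq_sum as ρ (sgn * u), hlen', Finset.mul_sum]
      refine Finset.sum_congr rfl fun a _ => ?_
      rw [Finset.mul_sum, Finset.mul_sum]
      refine Finset.sum_congr rfl fun b _ => ?_
      rw [mul_pow]; ring
    rw [intervalIntegral.integral_congr fun u _ => e1 u]
    have hint : ∀ b, IntervalIntegrable (fun u => K u * u ^ b) volume (-(h : ℝ)) h := fun b =>
      intervalIntegrable_kernel_mul hK (continuous_pow b)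
    set F : ℕ → ℝ → ℝ := fun a u => ∑ b ∈ range (n - a),
      (ρ ^ a * (as.getD (a + b) 0 * ((a + b).choose a : ℝ) * (sgn : ℝ) ^ b)) * (K u * u ^ b) with hF
    have hFi : ∀ a ∈ range n, IntervalIntegrable (F a) volume (-(h : ℝ)) h := by
      intro a _
      have : F a = ∑ b ∈ range (n - a), fun u =>
          (ρ ^ a * (as.getD (a + b) 0 * ((a + b).choose a : ℝ) * (sgn : ℝ) ^ b)) * (K u * u ^ b) := by
        funext u; simp only [hF, Finset.sum_apply]
      rw [this]
      exact IntervalIntegrable.sum (range (n - a)) fun b _ => (hint b).const_mul _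
    have step1 : ∫ u in (-(h : ℝ))..h, ∑ a ∈ range n, F a u = ∑ a ∈ range n, ∫ u in (-(h : ℝ))..h, F a u :=
      intervalIntegral.integral_finsetSum hFi
    have step2 : ∀ a, ∫ u in (-(h : ℝ))..h, F a u = ∑ b ∈ range (n - a),
        (ρ ^ a * (as.getD (a + b) 0 * ((a + b).choose a : ℝ) * (sgn : ℝ) ^ b)) * m b := by
      intro a
      simp only [hF]
      rw [intervalIntegral.integral_finsetSum fun b _ => (hint b).const_mul _]
      refine Finset.sum_congr rfl fun b _ => ?_
      rw [intervalIntegral.integral_const_mul]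
    rw [show (fun u => ∑ a ∈ range n, ∑ b ∈ range (n - a),
        ρ ^ a * (as.getD (a + b) 0 * ((a + b).choose a : ℝ) * (sgn : ℝ) ^ b) * (K u * u ^ b)) = fun u => ∑ a ∈ range n, F a u
        from rfl, step1]
    simp_rw [step2]
    rw [hcs, evalR_eq_sum, List.length_map, List.length_range]
    refine Finset.sum_congr rfl fun a ha => ?_
    have hget : ((List.range n).map fun a => ∑ b ∈ range (n - a),
        as.getD (a + b) 0 * ((a + b).choose a : ℝ) * (sgn : ℝ) ^ b * m b).getD a 0 =
        ∑ b ∈ range (n - a), as.getD (a + b) 0 * ((a + b).choose a : ℝ) * (sgn : ℝ) ^ b * m b := by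
      rw [List.getD_eq_getElem?_getD, List.getElem?_map, List.getElem?_range (Finset.mem_range.1 ha)]
      rfl
    rw [hget, Finset.sum_mul]
    refine Finset.sum_congr rfl fun b _ => ?_
    ring
  have hcsmem : PMem S cs (contrI S Atr mu sgn) := by
    rw [hcs, hn]
    exact pmem_contrI hS has (m := m) (fun b hb => hmu b hb) sgn
  -- the remainder part
  have hm0 : MI.mem S (m 0) (mu.getD 0 default) := by
    have := hmu 0 hlen
    simpa [hm] using this
  have hm0v : m 0 = ∫ u in (-(h : ℝ))..h, K u := by
    simp only [hm, pow_zero, mul_one]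
  have hKint_nonneg : 0 ≤ ∫ u in (-(h : ℝ))..h, K u :=
    intervalIntegral.integral_nonneg (by linarith) fun u hu => hK0 u hu
  have hrem_bd : |∫ u in (-(h : ℝ))..h, K u * r (ρ + sgn * u)| * S ≤
      ((⌈((e * (mu.getD 0 default).hi : ℤ) : ℚ) / S⌉ : ℤ) : ℝ) := by
    -- |∫ K r| ≤ ∫ K · (e/S) = (e/S) ∫K ≤ (e/S)(μ₀⁺/S)
    have he0 : (0 : ℝ) ≤ e := by
      have := hrem 0 (by rw [abs_zero]; exact_mod_cast le_trans (by linarith) hR)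
      exact le_trans (by positivity) this
    have h1 : |∫ u in (-(h : ℝ))..h, K u * r (ρ + sgn * u)| ≤ (e : ℝ) / S * ∫ u in (-(h : ℝ))..h, K u := by
      rw [← intervalIntegral.integral_const_mul]
      calc |∫ u in (-(h : ℝ))..h, K u * r (ρ + sgn * u)|
          ≤ ∫ u in (-(h : ℝ))..h, |K u * r (ρ + sgn * u)| :=
            intervalIntegral.abs_integral_le_integral_abs (by linarith)
        _ ≤ ∫ u in (-(h : ℝ))..h, (e : ℝ) / S * K u := by
            refine intervalIntegral.integral_mono_on (by linarith) hIr.abs (hK.const_mul _) fun u hu => ?_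
            rw [abs_mul, abs_of_nonneg (hK0 u hu), mul_comm]
            refine mul_le_mul_of_nonneg_right ?_ (hK0 u hu)
            have hb := hrem (ρ + sgn * u) (harg u hu)
            rw [le_div_iff₀ hSr]
            simpa [hr, hP] using hb
    have h2 : (∫ u in (-(h : ℝ))..h, K u) * S ≤ ((mu.getD 0 default).hi : ℝ) := by
      rw [← hm0v]; exact hm0.2
    have h3 : |∫ u in (-(h : ℝ))..h, K u * r (ρ + sgn * u)| * S ≤ (e : ℝ) * ((mu.getD 0 default).hi : ℝ) / S := by
      have := mul_le_mul_of_nonneg_right h1 hSr.le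
      calc |∫ u in (-(h : ℝ))..h, K u * r (ρ + sgn * u)| * S
          ≤ (e : ℝ) / S * (∫ u in (-(h : ℝ))..h, K u) * S := by simpa [mul_assoc] using this
        _ = (e : ℝ) / S * ((∫ u in (-(h : ℝ))..h, K u) * S) := by ring
        _ ≤ (e : ℝ) / S * ((mu.getD 0 default).hi : ℝ) := mul_le_mul_of_nonneg_left h2 (by positivity)
        _ = (e : ℝ) * ((mu.getD 0 default).hi : ℝ) / S := by ring
    refine h3.trans ?_
    have hc := (Rat.cast_le (K := ℝ)).2 (Int.le_ceil (((e * (mu.getD 0 default).hi : ℤ) : ℚ) / S))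
    push_cast at hc ⊢
    exact hc
  obtain ⟨bs, hbs, eb⟩ := exists_widen0 hcsmem hrem_bd ρ
  refine ⟨bs, hbs, ?_⟩
  beta_reduce
  rw [hsplit, hpoly, eb]

end Integral

end PolyMP

end Literature.Analysis.ValidatedNumerics
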